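import Mathlib
import HarnessLib
import Summits.HubbardSuperconductivity.HubbardSuperconductivity.Theorems.KLProgrammeH10TwoPointLimitPerturbedCountFold

/-!
# Route `KLProgramme` — K3 engine child `KLRegimeEngineV17F2` (stmt-HubbardSuperconductivity-20437), stub (b) import ι₂:
# the SIGNED fold-in-`t` key bound ON THE PERTURBED CURVE

Cell gate-hubbard-kl, plan g17 (R41)(i) «E1-P2-THIN-COUNT» (seat p4; plan HOME/prover-p4/E1-P2-THIN-COUNT-PLAN.md §Refinement 4, part (F3a) perturbed twin).
Twin of `BandSectorCounting.even_key_signed` (`ThinSectorFoldSignedKey`) for the perturbed level function: the landed `even_key_perturbed` (BGM App. A2,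
even shift, on the moving curve) is sign-blind, `(h_min/2)t ≤ |F′(t)|`; inside its proof the sign is the alignment `σ'` of the frozen sines `(sin S_x, sin S_y)`
with the perturbed curve point at the intermediate angle `ξ`.  Here the sign is read off the caller's alignment functional
`s·(sin S_x·sin X_E(x) + sin S_y·sin Y_E(x)) ≥ ι > 0` on the window `|x − σ| ≤ τ/2` (which contains `ξ`), and the conclusion keeps it:
`s·F′(t) ≤ −(h_min/2)·t`.  Same constants and smallness as `even_key_perturbed`, plus `2e_tot < ρ_min²`.

* `even_key_perturbed_signed`.

Everything is PROVED; no definitions.  References: BGM 2006 Lemma 3.1 / App. A2 [cite: BenfattoGiulianiMastropietro2006]; Mastropietro 2008 (14.67)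
p. 223, p. 229 [cite: Mastropietro2008].
-/

noncomputable section

namespace Summit.HubbardSuperconductivity.HubbardSuperconductivity.Theorems.PerturbedFermiCurve

set_option linter.dupNamespace false -- summit = problem name (single-conjunct summit), D-0017

open Real Set
open Literature.MathematicalPhysics.QuantumLattice Literature.MathematicalPhysics.QuantumLattice.BandSectorCounting

section FoldSigned

variable {a b : ℝ} (B : BandBounds a b) {δ : (Fin 2 → ℝ) → ℝ} (hδs : ContDiff ℝ 2 δ)
  {κ₀ κ₁ κ₂ μ : ℝ} (hδ : ∀ k : Fin 2 → ℝ, |δ k| ≤ κ₀) (hlo : a ≤ μ - κ₀) (hhi : μ + κ₀ ≤ b)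
  (hκ : ∀ k : Fin 2 → ℝ, ‖fderiv ℝ δ k‖ ≤ κ₁) (hκ₁ : κ₁ < B.Dtmin) (hκ₂ : ∀ k : Fin 2 → ℝ, ‖fderiv ℝ (fderiv ℝ δ) k‖ ≤ κ₂)
  {u : ℝ → ℝ} (hu : ∀ θ, IsBandFermiRadius (μ - δ (u θ • dir θ)) θ (u θ))
include B hδs hδ hlo hhi hκ hκ₁ hκ₂ hu

/-- **The signed fold-in-`t` key bound on the perturbed curve** (sign-aware `even_key_perturbed`): with the alignment functional
`s·(sin S_x·sin X_E + sin S_y·sin Y_E) ≥ ι > 0` on `|x − σ| ≤ τ/2` and `2e_tot < ρ_min²`, `s·F′(t) ≤ −(h_min/2)·t`.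
[cite: BenfattoGiulianiMastropietro2006, App. A2] -/
theorem even_key_perturbed_signed {Sx Sy μ' σ t τ η₀ lam ι s : ℝ} (hs01 : s = 1 ∨ s = -1) (ht0 : 0 < t) (htτ : t ≤ τ)
    (hμ' : μ' ∈ Icc a b)
    (hlo' : a ≤ μ' - η₀) (hhi' : μ' + η₀ ≤ b) (hh' : |eps2 Sx Sy - μ'| ≤ η₀)
    (hgap : ∀ θ, |μ' - (μ - δ (u θ • dir θ))| ≤ 2 * κ₀) {S : Fin 2 → ℝ}
    (hG : |(2 * Real.sin Sx * VXE u (σ - t / 2) + 2 * Real.sin Sy * VYE u (σ - t / 2) +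
            fderiv ℝ δ S ![VXE u (σ - t / 2), VYE u (σ - t / 2)]) +
          (2 * Real.sin Sx * VXE u (σ + t / 2) + 2 * Real.sin Sy * VYE u (σ + t / 2) +
            fderiv ℝ δ S ![VXE u (σ + t / 2), VYE u (σ + t / 2)])| ≤ 4 * lam)
    (hsmall :
      4 * (κ₁ * (π * Real.sqrt 2 + 2 * B.smax) / (B.Dtmin - κ₁)) * ((B.smax + κ₁ * (π * Real.sqrt 2 + 2 * B.smax) / (B.Dtmin - κ₁)) + B.smax) +
          (κ₂ * (B.smax + κ₁ * (π * Real.sqrt 2 + 2 * B.smax) / (B.Dtmin - κ₁)) ^ 2 + κ₁ * ((((4 + κ₂) * (B.smax + κ₁ * (π * Real.sqrt 2 + 2 * B.smax) / (B.Dtmin - κ₁)) ^ 2 + (8 + 2 * κ₁) * ((4 + κ₁) * (π * Real.sqrt 2) / (B.Dtmin - κ₁)) + (4 + κ₁) * (π * Real.sqrt 2)) / (B.Dtmin - κ₁)) + 2 * ((4 + κ₁) * (π * Real.sqrt 2) / (B.Dtmin - κ₁)) + π * Real.sqrt 2)) / 2 +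
        2 * ((((4 + κ₂) * (B.smax + κ₁ * (π * Real.sqrt 2 + 2 * B.smax) / (B.Dtmin - κ₁)) ^ 2 + (8 + 2 * κ₁) * ((4 + κ₁) * (π * Real.sqrt 2) / (B.Dtmin - κ₁)) + (4 + κ₁) * (π * Real.sqrt 2)) / (B.Dtmin - κ₁)) + 2 * ((4 + κ₁) * (π * Real.sqrt 2) / (B.Dtmin - κ₁)) + π * Real.sqrt 2) *
          (η₀ / B.Dtmin + 2 * κ₀ / B.Dtmin + B.smax * (B.Cg * ((2 * lam + (4 + κ₁) * ((((4 + κ₂) * (B.smax + κ₁ * (π * Real.sqrt 2 + 2 * B.smax) / (B.Dtmin - κ₁)) ^ 2 + (8 + 2 * κ₁) * ((4 + κ₁) * (π * Real.sqrt 2) / (B.Dtmin - κ₁)) + (4 + κ₁) * (π * Real.sqrt 2)) / (B.Dtmin - κ₁)) + 2 * ((4 + κ₁) * (π * Real.sqrt 2) / (B.Dtmin - κ₁)) + π * Real.sqrt 2) * τ / 2) / 2 + κ₁ * (B.smax + κ₁ * (π * Real.sqrt 2 + 2 * B.smax) / (B.Dtmin - κ₁)) / 2 + 2 * (κ₁ *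 (π * Real.sqrt 2 + 2 * B.smax) / (B.Dtmin - κ₁)) + 2 * B.smax * (η₀ / B.Dtmin) + 2 * B.smax * (2 * κ₀ / B.Dtmin)) + τ / 2)) +
        κ₁ * ((((4 + κ₂) * (B.smax + κ₁ * (π * Real.sqrt 2 + 2 * B.smax) / (B.Dtmin - κ₁)) ^ 2 + (8 + 2 * κ₁) * ((4 + κ₁) * (π * Real.sqrt 2) / (B.Dtmin - κ₁)) + (4 + κ₁) * (π * Real.sqrt 2)) / (B.Dtmin - κ₁)) + 2 * ((4 + κ₁) * (π * Real.sqrt 2) / (B.Dtmin - κ₁)) + π * Real.sqrt 2) / 2 ≤ B.hmin / 2)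
    (hρ : 2 * (η₀ / B.Dtmin + 2 * κ₀ / B.Dtmin + B.smax * (B.Cg * ((2 * lam + (4 + κ₁) * ((((4 + κ₂) * (B.smax + κ₁ * (π * Real.sqrt 2 + 2 * B.smax) / (B.Dtmin - κ₁)) ^ 2 + (8 + 2 * κ₁) * ((4 + κ₁) * (π * Real.sqrt 2) / (B.Dtmin - κ₁)) + (4 + κ₁) * (π * Real.sqrt 2)) / (B.Dtmin - κ₁)) + 2 * ((4 + κ₁) * (π * Real.sqrt 2) / (B.Dtmin - κ₁)) + π * Real.sqrt 2) * τ / 2) / 2 + κ₁ * (B.smax + κ₁ * (π * Real.sqrt 2 + 2 * B.smax) / (B.Dtmin - κ₁)) / 2 + 2 * (κ₁ * (π * Real.sqrt 2 + 2 * B.smax) / (B.Dtmin - κ₁)) + 2 * B.smax * (η₀ / B.Dtmin) + 2 * B.smax * (2 * κ₀ / B.Dtmin)) + τ / 2)) < B.rhomin ^ 2)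
    (hι : 0 < ι)
    (hI : ∀ x ∈ Icc (σ - τ / 2) (σ + τ / 2), ι ≤ s * (Real.sin Sx * Real.sin (XE u x) + Real.sin Sy * Real.sin (YE u x))) :
    s * (Real.sin Sx * (VXE u (σ + t / 2) - VXE u (σ - t / 2)) +
        Real.sin Sy * (VYE u (σ + t / 2) - VYE u (σ - t / 2)) +
        fderiv ℝ δ S ![(VXE u (σ + t / 2) - VXE u (σ - t / 2)) / 2, (VYE u (σ + t / 2) - VYE u (σ - t / 2)) / 2]) ≤
      -(B.hmin / 2) * t := by
  have h2ne : (2 : WithTop ℕ∞) ≠ 0 := by norm_num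
  have hδ' : ∀ k : Fin 2 → ℝ, (∀ i, |k i| ≤ π) → |δ k| ≤ κ₀ := fun k _ => hδ k
  have hκ' : ∀ k : Fin 2 → ℝ, (∀ i, |k i| ≤ π) → ‖fderiv ℝ δ k‖ ≤ κ₁ := fun k _ => hκ k
  have hκ₂' : ∀ k : Fin 2 → ℝ, (∀ i, |k i| ≤ π) → ‖fderiv ℝ (fderiv ℝ δ) k‖ ≤ κ₂ := fun k _ => hκ₂ k
  have hs := B.smax_pos; have hDt := B.Dtmin_pos; have hCg := B.Cg_pos
  have hden : 0 < B.Dtmin - κ₁ := sub_pos.2 hκ₁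
  have hκ₁0 : 0 ≤ κ₁ := (norm_nonneg _).trans (hκ S)
  have hκ₂0 : 0 ≤ κ₂ := (norm_nonneg (fderiv ℝ (fderiv ℝ δ) S)).trans (hκ₂ S)
  have hτ : 0 < τ := ht0.trans_le htτ
  have ht2 : 0 < t / 2 := half_pos ht0
  -- lemma instances carrying the constants (instantiated BEFORE abbreviating)
  obtain ⟨hvm, hwm⟩ := abs_VXE_sub_VXE_le B hδs hδ hlo hhi hκ hκ₁ hκ₂ hu σ (σ - t / 2)
  obtain ⟨hvp, hwp⟩ := abs_VXE_sub_VXE_le B hδs hδ hlo hhi hκ hκ₁ hκ₂ hu σ (σ + t / 2)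
  obtain ⟨hvpm, hwpm⟩ := abs_VXE_sub_VXE_le B hδs hδ hlo hhi hκ hκ₁ hκ₂ hu (σ + t / 2) (σ - t / 2)
  rw [show σ - (σ - t / 2) = t / 2 by ring, abs_of_pos ht2] at hvm hwm
  rw [show σ - (σ + t / 2) = -(t / 2) by ring, abs_neg, abs_of_pos ht2] at hvp hwp
  rw [show σ + t / 2 - (σ - t / 2) = t by ring, abs_of_pos ht0] at hvpm hwpm
  -- the frozen-coefficient mean value theorem on `[σ - t/2, σ + t/2]`
  have hu2 : ContDiff ℝ 2 u := contDiff_of_isRoot B hδs h2ne hδ' hlo hhi hκ' hκ₁ hu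
  have hud : ∀ x, DifferentiableAt ℝ u x := fun x => (hu2.differentiable h2ne) x
  have hud' : ∀ x, DifferentiableAt ℝ (deriv u) x := by
    have h2 : ContDiff ℝ ((1 : WithTop ℕ∞) + 1) u := by rw [one_add_one_eq_two]; exact hu2
    have h : ContDiff ℝ 1 (deriv u) := (contDiff_succ_iff_deriv.1 h2).2.2
    exact fun x => (h.differentiable one_ne_zero) x
  have hfd : ∀ x, HasDerivAt (fun x => Real.sin Sx * VXE u x + Real.sin Sy * VYE u x)
      (Real.sin Sx * (deriv (deriv u) x * Real.cos x - 2 * deriv u x * Real.sin x - u x * Real.cos x) +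
        Real.sin Sy * (deriv (deriv u) x * Real.sin x + 2 * deriv u x * Real.cos x - u x * Real.sin x)) x := fun x =>
    ((hasDerivAt_VXE (hud x) (hud' x)).const_mul (Real.sin Sx)).add
      ((hasDerivAt_VYE (hud x) (hud' x)).const_mul (Real.sin Sy))
  obtain ⟨ξ, hξ, hslope⟩ := exists_slope hfd (σ - t / 2) t
  rw [show σ - t / 2 + t = σ + t / 2 by ring] at hslope
  obtain ⟨hAXb, hAYb⟩ := abs_accel_le B hδs hδ hlo hhi hκ hκ₁ hκ₂ hu ξ
  have hcoreE := abs_sin_mul_accel_ge B hδs hδ' hlo hhi hκ' hκ₁ hκ₂' hu ξ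
  set AX := deriv (deriv u) ξ * Real.cos ξ - 2 * deriv u ξ * Real.sin ξ - u ξ * Real.cos ξ with hAX
  set AY := deriv (deriv u) ξ * Real.sin ξ + 2 * deriv u ξ * Real.cos ξ - u ξ * Real.sin ξ with hAY
  -- constants (abbreviated, then made opaque)
  set CV := κ₁ * (π * Real.sqrt 2 + 2 * B.smax) / (B.Dtmin - κ₁) with hCV
  set SE := B.smax + CV with hSE
  set U1 := (4 + κ₁) * (π * Real.sqrt 2) / (B.Dtmin - κ₁) with hU1
  set U2 := ((4 + κ₂) * SE ^ 2 + (8 + 2 * κ₁) * U1 + (4 + κ₁) * (π * Real.sqrt 2)) / (B.Dtmin - κ₁) with hU2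
  set AE := U2 + 2 * U1 + π * Real.sqrt 2 with hAE
  set lam' := 2 * lam + (4 + κ₁) * AE * τ / 2 with hlam'
  set ε4 := lam' / 2 + κ₁ * SE / 2 + 2 * CV + 2 * B.smax * (η₀ / B.Dtmin) + 2 * B.smax * (2 * κ₀ / B.Dtmin) with hε4
  set etot := η₀ / B.Dtmin + 2 * κ₀ / B.Dtmin + B.smax * (B.Cg * ε4 + τ / 2) with hetot
  clear_value etot ε4 lam' AE U2 U1 SE CV
  have hAE0 : 0 ≤ AE := (abs_nonneg _).trans hAXb
  -- Step 1: the perturbed partial at the midpoint `σ` is small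
  have hmid : |2 * Real.sin Sx * VXE u σ + 2 * Real.sin Sy * VYE u σ + fderiv ℝ δ S ![VXE u σ, VYE u σ]| ≤ lam' := by
    have ex : |2 * VXE u σ - VXE u (σ - t / 2) - VXE u (σ + t / 2)| ≤ AE * t := by
      rw [show 2 * VXE u σ - VXE u (σ - t / 2) - VXE u (σ + t / 2) =
        (VXE u σ - VXE u (σ - t / 2)) + (VXE u σ - VXE u (σ + t / 2)) by ring]
      refine (abs_add_le _ _).trans ?_; linarith
    have ey : |2 * VYE u σ - VYE u (σ - t / 2) - VYE u (σ + t / 2)| ≤ AE * t := by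
      rw [show 2 * VYE u σ - VYE u (σ - t / 2) - VYE u (σ + t / 2) =
        (VYE u σ - VYE u (σ - t / 2)) + (VYE u σ - VYE u (σ + t / 2)) by ring]
      refine (abs_add_le _ _).trans ?_; linarith
    have hD : |fderiv ℝ δ S ![2 * VXE u σ - VXE u (σ - t / 2) - VXE u (σ + t / 2),
        2 * VYE u σ - VYE u (σ - t / 2) - VYE u (σ + t / 2)]| ≤ κ₁ * (AE * t) :=
      abs_fderiv_vec2_le (hκ S) (by positivity) ex ey
    have hx : |2 * Real.sin Sx * (2 * VXE u σ - VXE u (σ - t / 2) - VXE u (σ + t / 2))| ≤ 2 * (AE * t) := by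
      rw [abs_mul, abs_mul, abs_two]
      have h3 : |Real.sin Sx| * |2 * VXE u σ - VXE u (σ - t / 2) - VXE u (σ + t / 2)| ≤ 1 * (AE * t) :=
        mul_le_mul (Real.abs_sin_le_one Sx) ex (abs_nonneg _) zero_le_one
      linarith
    have hy : |2 * Real.sin Sy * (2 * VYE u σ - VYE u (σ - t / 2) - VYE u (σ + t / 2))| ≤ 2 * (AE * t) := by
      rw [abs_mul, abs_mul, abs_two]
      have h3 : |Real.sin Sy| * |2 * VYE u σ - VYE u (σ - t / 2) - VYE u (σ + t / 2)| ≤ 1 * (AE * t) :=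
        mul_le_mul (Real.abs_sin_le_one Sy) ey (abs_nonneg _) zero_le_one
      linarith
    have hid : 2 * (2 * Real.sin Sx * VXE u σ + 2 * Real.sin Sy * VYE u σ + fderiv ℝ δ S ![VXE u σ, VYE u σ]) -
        ((2 * Real.sin Sx * VXE u (σ - t / 2) + 2 * Real.sin Sy * VYE u (σ - t / 2) +
            fderiv ℝ δ S ![VXE u (σ - t / 2), VYE u (σ - t / 2)]) +
          (2 * Real.sin Sx * VXE u (σ + t / 2) + 2 * Real.sin Sy * VYE u (σ + t / 2) +
            fderiv ℝ δ S ![VXE u (σ + t / 2), VYE u (σ + t / 2)])) =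
        2 * Real.sin Sx * (2 * VXE u σ - VXE u (σ - t / 2) - VXE u (σ + t / 2)) +
          2 * Real.sin Sy * (2 * VYE u σ - VYE u (σ - t / 2) - VYE u (σ + t / 2)) +
          fderiv ℝ δ S ![2 * VXE u σ - VXE u (σ - t / 2) - VXE u (σ + t / 2),
            2 * VYE u σ - VYE u (σ - t / 2) - VYE u (σ + t / 2)] := by
      rw [← clm_vec2_sub, ← clm_vec2_sub, ← clm_vec2_smul]; ring
    have htri := abs_sub_abs_le_abs_sub
      (2 * (2 * Real.sin Sx * VXE u σ + 2 * Real.sin Sy * VYE u σ + fderiv ℝ δ S ![VXE u σ, VYE u σ]))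
      ((2 * Real.sin Sx * VXE u (σ - t / 2) + 2 * Real.sin Sy * VYE u (σ - t / 2) +
            fderiv ℝ δ S ![VXE u (σ - t / 2), VYE u (σ - t / 2)]) +
          (2 * Real.sin Sx * VXE u (σ + t / 2) + 2 * Real.sin Sy * VYE u (σ + t / 2) +
            fderiv ℝ δ S ![VXE u (σ + t / 2), VYE u (σ + t / 2)]))
    rw [hid] at htri
    have h3 := abs_add_le (2 * Real.sin Sx * (2 * VXE u σ - VXE u (σ - t / 2) - VXE u (σ + t / 2)) +
          2 * Real.sin Sy * (2 * VYE u σ - VYE u (σ - t / 2) - VYE u (σ + t / 2)))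
      (fderiv ℝ δ S ![2 * VXE u σ - VXE u (σ - t / 2) - VXE u (σ + t / 2),
            2 * VYE u σ - VYE u (σ - t / 2) - VYE u (σ + t / 2)])
    have h4 := abs_add_le (2 * Real.sin Sx * (2 * VXE u σ - VXE u (σ - t / 2) - VXE u (σ + t / 2)))
          (2 * Real.sin Sy * (2 * VYE u σ - VYE u (σ - t / 2) - VYE u (σ + t / 2)))
    rw [abs_mul, abs_two] at htri
    have hmono : (4 + κ₁) * (AE * t) ≤ (4 + κ₁) * (AE * τ) :=
      mul_le_mul_of_nonneg_left (mul_le_mul_of_nonneg_left htτ hAE0) (by linarith)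
    have e : lam' = 2 * lam + (4 + κ₁) * (AE * τ) / 2 := by rw [hlam']; ring
    rw [e]
    linarith
  -- Step 2: localisation of the momentum sum and alignment of `σ`
  obtain ⟨φ, hsx, hsy, -, -⟩ := exists_near_curve_trig B hμ' hh' hlo' hhi'
  obtain ⟨j, hj⟩ := exists_int_near_of_h3E_small B hδs h2ne hδ hlo hhi hκ hκ₁ hu hμ' hsx hsy σ (hgap σ) hmid
  rw [← hCV, ← hSE, ← hε4] at hj
  -- Step 3: the values on the anti-diagonal through the mean value theorem
  have hval : Real.sin Sx * (VXE u (σ + t / 2) - VXE u (σ - t / 2)) + Real.sin Sy * (VYE u (σ + t / 2) - VYE u (σ - t / 2)) =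
      t * (Real.sin Sx * AX + Real.sin Sy * AY) := by
    linarith [hslope]
  have hξσ : |ξ - σ| ≤ τ / 2 := by
    rw [min_eq_left ht0.le, max_eq_right ht0.le] at hξ
    rw [abs_le]; constructor <;> linarith [hξ.1, hξ.2]
  -- Step 4: alignment of `ξ` with `φ`; the sines of the sum against the perturbed point at `ξ`
  have halign : |φ - ξ - j * π| ≤ B.Cg * ε4 + τ / 2 := by
    calc |φ - ξ - j * π| = |(φ - σ - j * π) + (σ - ξ)| := by ring_nf
      _ ≤ |φ - σ - j * π| + |σ - ξ| := abs_add_le _ _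
      _ ≤ B.Cg * ε4 + τ / 2 := add_le_add hj (by rw [abs_sub_comm]; exact hξσ)
  set νξ := μ - δ (u ξ • dir ξ) with hνξ
  have hνξmem : νξ ∈ Icc a b := shiftedLevel_mem_Icc (hu ξ) hδ' hlo hhi
  obtain ⟨σ', hσ', ax, ay, -, -⟩ := exists_sign_align B hνξmem halign
  have hσabs : |σ'| = 1 := by rcases hσ' with rfl | rfl <;> norm_num
  obtain ⟨hXξ, hYξ⟩ := XE_eq_bandX_shifted B hδ' hlo hhi hu ξ
  have hradφ : |bandFermiRadius μ' φ - bandFermiRadius νξ φ| ≤ 2 * κ₀ / B.Dtmin :=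
    (abs_bandFermiRadius_sub_le_of_level B hνξmem hμ' φ).trans (div_le_div_of_nonneg_right (hgap ξ) hDt.le)
  have s2x : |Real.sin (bandX μ' φ) - Real.sin (bandX νξ φ)| ≤ 2 * κ₀ / B.Dtmin := by
    refine (Real.abs_sin_sub_sin_le _ _).trans ?_
    rw [bandX, bandX, ← sub_mul, abs_mul]
    exact (mul_le_of_le_one_right (abs_nonneg _) (Real.abs_cos_le_one φ)).trans hradφ
  have s2y : |Real.sin (bandY μ' φ) - Real.sin (bandY νξ φ)| ≤ 2 * κ₀ / B.Dtmin := by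
    refine (Real.abs_sin_sub_sin_le _ _).trans ?_
    rw [bandY, bandY, ← sub_mul, abs_mul]
    exact (mul_le_of_le_one_right (abs_nonneg _) (Real.abs_sin_le_one φ)).trans hradφ
  have cx : |σ' * Real.sin Sx - Real.sin (XE u ξ)| ≤ etot := by
    rw [hXξ]
    have e : σ' * Real.sin Sx - Real.sin (bandX νξ ξ) =
        σ' * ((Real.sin Sx - Real.sin (bandX μ' φ)) + (Real.sin (bandX μ' φ) - Real.sin (bandX νξ φ))) +
          (σ' * Real.sin (bandX νξ φ) - Real.sin (bandX νξ ξ)) := by ring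
    rw [e]
    refine (abs_add_le _ _).trans ?_
    rw [abs_mul, hσabs, one_mul]
    have := abs_add_le (Real.sin Sx - Real.sin (bandX μ' φ)) (Real.sin (bandX μ' φ) - Real.sin (bandX νξ φ))
    rw [hetot]; linarith
  have cy : |σ' * Real.sin Sy - Real.sin (YE u ξ)| ≤ etot := by
    rw [hYξ]
    have e : σ' * Real.sin Sy - Real.sin (bandY νξ ξ) =
        σ' * ((Real.sin Sy - Real.sin (bandY μ' φ)) + (Real.sin (bandY μ' φ) - Real.sin (bandY νξ φ))) +
          (σ' * Real.sin (bandY νξ φ) - Real.sin (bandY νξ ξ)) := by ring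
    rw [e]
    refine (abs_add_le _ _).trans ?_
    rw [abs_mul, hσabs, one_mul]
    have := abs_add_le (Real.sin Sy - Real.sin (bandY μ' φ)) (Real.sin (bandY μ' φ) - Real.sin (bandY νξ φ))
    rw [hetot]; linarith
  -- Step 5 (signed): the alignment sign `σ'` is the caller's `s`
  have hetot0 : 0 ≤ etot := (abs_nonneg _).trans cx
  have hξI : ξ ∈ Icc (σ - τ / 2) (σ + τ / 2) := by
    rw [abs_le] at hξσ; constructor <;> linarith [hξσ.1, hξσ.2]
  have hρξ : B.rhomin ^ 2 ≤ Real.sin (XE u ξ) ^ 2 + Real.sin (YE u ξ) ^ 2 := by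
    rw [hXξ, hYξ]
    have h0 := B.rho_ge νξ hνξmem ξ
    have hρ0 := B.rhomin_pos
    calc B.rhomin ^ 2 ≤ (Real.sqrt (Real.sin (bandX νξ ξ) ^ 2 + Real.sin (bandY νξ ξ) ^ 2)) ^ 2 := by gcongr
      _ = Real.sin (bandX νξ ξ) ^ 2 + Real.sin (bandY νξ ξ) ^ 2 := Real.sq_sqrt (by positivity)
  set J := Real.sin Sx * Real.sin (XE u ξ) + Real.sin Sy * Real.sin (YE u ξ) with hJ
  have hσJ : 0 < σ' * J := by
    have e : σ' * J = Real.sin (XE u ξ) ^ 2 + Real.sin (YE u ξ) ^ 2 +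
        ((σ' * Real.sin Sx - Real.sin (XE u ξ)) * Real.sin (XE u ξ) +
          (σ' * Real.sin Sy - Real.sin (YE u ξ)) * Real.sin (YE u ξ)) := by rw [hJ]; ring
    have b := abs_two_term_le cx (Real.abs_sin_le_one (XE u ξ)) cy (Real.abs_sin_le_one (YE u ξ))
    have b' := neg_abs_le ((σ' * Real.sin Sx - Real.sin (XE u ξ)) * Real.sin (XE u ξ) +
          (σ' * Real.sin Sy - Real.sin (YE u ξ)) * Real.sin (YE u ξ))
    have hρ' : 2 * etot < B.rhomin ^ 2 := hρ
    rw [e]; linarith only [hρξ, hρ', b, b']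
  have hsJ : 0 < s * J := lt_of_lt_of_le hι (hI ξ hξI)
  have hsσ : s = σ' := by
    rcases hs01 with h1 | h1 <;> rcases hσ' with h2 | h2
    · rw [h1, h2]
    · exfalso; rw [h1] at hsJ; rw [h2] at hσJ; linarith only [hsJ, hσJ]
    · exfalso; rw [h1] at hsJ; rw [h2] at hσJ; linarith only [hsJ, hσJ]
    · rw [h1, h2]
  -- Step 6 (signed core): `σ'·(sin Sx·AX + sin Sy·AY) ≤ −(h_min/2 + κ₁A_E/2)`
  have haccle : Real.sin (XE u ξ) * AX + Real.sin (YE u ξ) * AY ≤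
      -(B.hmin - 4 * CV * (SE + B.smax) - (κ₂ * SE ^ 2 + κ₁ * AE) / 2) := by
    have hsq := abs_apply_le_pi_of_isBandFermiRadius (hu ξ)
    have heq := sin_mul_accel_eq B hδs hδ' hlo hhi hκ' hκ₁ hu ξ
    have hhess := hess_perturbed_ge B hδs hδ' hlo hhi hκ' hκ₁ hu ξ
    obtain ⟨hvx, hvy⟩ := abs_VXE_le B hδs h2ne hδ' hlo hhi hκ' hκ₁ hu ξ
    have hSE0 : 0 ≤ SE := by rw [hSE, hCV]; exact (abs_nonneg _).trans hvx
    have hv : ‖(![VXE u ξ, VYE u ξ] : Fin 2 → ℝ)‖ ≤ SE := by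
      rw [hSE, hCV]; exact norm_vec2_le ((abs_nonneg _).trans hvx) hvx hvy
    have hD2 : |fderiv ℝ (fderiv ℝ δ) (u ξ • dir ξ) ![VXE u ξ, VYE u ξ] ![VXE u ξ, VYE u ξ]| ≤ κ₂ * SE ^ 2 := by
      refine (abs_fderiv_fderiv_le (hκ₂ _) ![VXE u ξ, VYE u ξ] ![VXE u ξ, VYE u ξ]).trans ?_
      rw [sq, mul_assoc]
      exact mul_le_mul_of_nonneg_left (mul_le_mul hv hv (norm_nonneg _) hSE0) hκ₂0
    have hD1 : |fderiv ℝ δ (u ξ • dir ξ) ![AX, AY]| ≤ κ₁ * AE := abs_fderiv_vec2_le (hκ _) hAE0 hAXb hAYb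
    have hD1' := (abs_le.1 hD1).1
    have hD2' := (abs_le.1 hD2).1
    rw [← hCV, ← hSE] at hhess
    rw [hAX, hAY] at hD1' ⊢
    rw [heq]
    linarith only [hhess, hD1', hD2']
  have hcoreS : σ' * (Real.sin Sx * AX + Real.sin Sy * AY) ≤ -(B.hmin / 2 + κ₁ * AE / 2) := by
    have e1 : σ' * (Real.sin Sx * AX + Real.sin Sy * AY) =
        (Real.sin (XE u ξ) * AX + Real.sin (YE u ξ) * AY) +
        ((σ' * Real.sin Sx - Real.sin (XE u ξ)) * AX + (σ' * Real.sin Sy - Real.sin (YE u ξ)) * AY) := by ring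
    have hRb : |(σ' * Real.sin Sx - Real.sin (XE u ξ)) * AX + (σ' * Real.sin Sy - Real.sin (YE u ξ)) * AY| ≤ etot * AE + etot * AE := by
      refine (abs_add_le _ _).trans ?_
      rw [abs_mul, abs_mul]
      exact add_le_add (mul_le_mul cx hAXb (abs_nonneg _) hetot0) (mul_le_mul cy hAYb (abs_nonneg _) hetot0)
    have hR' := le_abs_self ((σ' * Real.sin Sx - Real.sin (XE u ξ)) * AX + (σ' * Real.sin Sy - Real.sin (YE u ξ)) * AY)
    rw [e1]
    linarith only [hRb, hR', haccle, hsmall]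
  -- Step 7: the `Dδ` part of the `t`-derivative is `≤ κ₁ A_E t / 2` in modulus
  have hDpart : |fderiv ℝ δ S ![(VXE u (σ + t / 2) - VXE u (σ - t / 2)) / 2, (VYE u (σ + t / 2) - VYE u (σ - t / 2)) / 2]| ≤
      κ₁ * (AE * t / 2) := by
    refine abs_fderiv_vec2_le (hκ S) (div_nonneg (mul_nonneg hAE0 ht0.le) (by norm_num)) ?_ ?_
    · rw [abs_div, abs_two]; linarith only [hvpm]
    · rw [abs_div, abs_two]; linarith only [hwpm]
  have hsabs : |s| = 1 := by
    rcases hs01 with h1 | h1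
    · rw [h1]; exact abs_one
    · rw [h1, abs_neg, abs_one]
  have hDs : s * fderiv ℝ δ S ![(VXE u (σ + t / 2) - VXE u (σ - t / 2)) / 2, (VYE u (σ + t / 2) - VYE u (σ - t / 2)) / 2] ≤
      κ₁ * (AE * t / 2) := by
    have := le_abs_self (s * fderiv ℝ δ S ![(VXE u (σ + t / 2) - VXE u (σ - t / 2)) / 2, (VYE u (σ + t / 2) - VYE u (σ - t / 2)) / 2])
    rw [abs_mul, hsabs, one_mul] at this
    linarith only [this, hDpart]
  have hmainS : s * (Real.sin Sx * (VXE u (σ + t / 2) - VXE u (σ - t / 2)) +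
      Real.sin Sy * (VYE u (σ + t / 2) - VYE u (σ - t / 2))) ≤ -(B.hmin / 2 + κ₁ * AE / 2) * t := by
    rw [hval]
    have h1 : s * (t * (Real.sin Sx * AX + Real.sin Sy * AY)) = t * (σ' * (Real.sin Sx * AX + Real.sin Sy * AY)) := by
      rw [hsσ, mul_left_comm]
    rw [h1]
    have h2 := mul_le_mul_of_nonneg_left hcoreS ht0.le
    have e4 : t * -(B.hmin / 2 + κ₁ * AE / 2) = -(B.hmin / 2 + κ₁ * AE / 2) * t := mul_comm _ _
    rw [e4] at h2
    exact h2
  rw [mul_add]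
  have e2 : κ₁ * (AE * t / 2) = (κ₁ * AE / 2) * t := by ring
  have e3 : -(B.hmin / 2 + κ₁ * AE / 2) * t = -(B.hmin / 2) * t - (κ₁ * AE / 2) * t := by ring
  rw [e2] at hDs; rw [e3] at hmainS
  linarith only [hDs, hmainS]

/-- **The signed key bound of a perturbed anti-diagonal fibre with the TRUE `t`-derivative of `h^E`** (the sign-aware `anti_key_perturbed`):
`s·(d/dt) h^E(σ − t/2, σ + t/2) ≤ −(h_min/2)·t` when the alignment functional of the frozen sines with the perturbed curve is `≥ ι > 0` with sign `s` on
`|x − σ| ≤ τ/2`. [cite: BenfattoGiulianiMastropietro2006, App. A2] -/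
theorem anti_key_perturbed_signed {P : ℝ × ℝ} {σ t τ η₀ lam ι s : ℝ} (hs01 : s = 1 ∨ s = -1) (ht0 : 0 < t) (htτ : t ≤ τ)
    (hlo' : a ≤ μ - κ₀ - η₀) (hhi' : μ + κ₀ + η₀ ≤ b)
    (hF : |hfunE δ u μ P (σ - t / 2) (σ + t / 2)| ≤ η₀)
    (hG : |h3E δ u P (σ + t / 2) (σ - t / 2) + h3E δ u P (σ - t / 2) (σ + t / 2)| ≤ 4 * lam)
    (hsmall :
      4 * (κ₁ * (π * Real.sqrt 2 + 2 * B.smax) / (B.Dtmin - κ₁)) * ((B.smax + κ₁ * (π * Real.sqrt 2 + 2 * B.smax) / (B.Dtmin - κ₁)) + B.smax) +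
          (κ₂ * (B.smax + κ₁ * (π * Real.sqrt 2 + 2 * B.smax) / (B.Dtmin - κ₁)) ^ 2 + κ₁ * ((((4 + κ₂) * (B.smax + κ₁ * (π * Real.sqrt 2 + 2 * B.smax) / (B.Dtmin - κ₁)) ^ 2 + (8 + 2 * κ₁) * ((4 + κ₁) * (π * Real.sqrt 2) / (B.Dtmin - κ₁)) + (4 + κ₁) * (π * Real.sqrt 2)) / (B.Dtmin - κ₁)) + 2 * ((4 + κ₁) * (π * Real.sqrt 2) / (B.Dtmin - κ₁)) + π * Real.sqrt 2)) / 2 +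
        2 * ((((4 + κ₂) * (B.smax + κ₁ * (π * Real.sqrt 2 + 2 * B.smax) / (B.Dtmin - κ₁)) ^ 2 + (8 + 2 * κ₁) * ((4 + κ₁) * (π * Real.sqrt 2) / (B.Dtmin - κ₁)) + (4 + κ₁) * (π * Real.sqrt 2)) / (B.Dtmin - κ₁)) + 2 * ((4 + κ₁) * (π * Real.sqrt 2) / (B.Dtmin - κ₁)) + π * Real.sqrt 2) *
          (η₀ / B.Dtmin + 2 * κ₀ / B.Dtmin + B.smax * (B.Cg * ((2 * lam + (4 + κ₁) * ((((4 + κ₂) * (B.smax + κ₁ * (π * Real.sqrt 2 + 2 * B.smax) / (B.Dtmin - κ₁)) ^ 2 + (8 + 2 * κ₁) * ((4 + κ₁) * (π * Real.sqrt 2) / (B.Dtmin - κ₁)) + (4 + κ₁) * (π * Real.sqrt 2)) / (B.Dtmin - κ₁)) + 2 * ((4 + κ₁) * (π * Real.sqrt 2) / (B.Dtmin - κ₁)) + π * Real.sqrt 2) * τ / 2) / 2 + κ₁ * (B.smax + κ₁ * (π * Real.sqrt 2 + 2 * B.smax) / (B.Dtmin - κ₁)) / 2 + 2 * (κ₁ *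 (π * Real.sqrt 2 + 2 * B.smax) / (B.Dtmin - κ₁)) + 2 * B.smax * (η₀ / B.Dtmin) + 2 * B.smax * (2 * κ₀ / B.Dtmin)) + τ / 2)) +
        κ₁ * ((((4 + κ₂) * (B.smax + κ₁ * (π * Real.sqrt 2 + 2 * B.smax) / (B.Dtmin - κ₁)) ^ 2 + (8 + 2 * κ₁) * ((4 + κ₁) * (π * Real.sqrt 2) / (B.Dtmin - κ₁)) + (4 + κ₁) * (π * Real.sqrt 2)) / (B.Dtmin - κ₁)) + 2 * ((4 + κ₁) * (π * Real.sqrt 2) / (B.Dtmin - κ₁)) + π * Real.sqrt 2) / 2 ≤ B.hmin / 2)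
    (hρ : 2 * (η₀ / B.Dtmin + 2 * κ₀ / B.Dtmin + B.smax * (B.Cg * ((2 * lam + (4 + κ₁) * ((((4 + κ₂) * (B.smax + κ₁ * (π * Real.sqrt 2 + 2 * B.smax) / (B.Dtmin - κ₁)) ^ 2 + (8 + 2 * κ₁) * ((4 + κ₁) * (π * Real.sqrt 2) / (B.Dtmin - κ₁)) + (4 + κ₁) * (π * Real.sqrt 2)) / (B.Dtmin - κ₁)) + 2 * ((4 + κ₁) * (π * Real.sqrt 2) / (B.Dtmin - κ₁)) + π * Real.sqrt 2) * τ / 2) / 2 + κ₁ * (B.smax + κ₁ * (π * Real.sqrt 2 + 2 * B.smax) / (B.Dtmin - κ₁)) / 2 + 2 * (κ₁ * (π * Real.sqrt 2 + 2 * B.smax) / (B.Dtmin - κ₁)) + 2 * B.smax * (η₀ / B.Dtmin) + 2 * B.smax * (2 * κ₀ / B.Dtmin)) + τ / 2)) < B.rhomin ^ 2)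
    (hι : 0 < ι)
    (hI : ∀ x ∈ Icc (σ - τ / 2) (σ + τ / 2), ι ≤ s * (Real.sin (SXE u P (σ - t / 2) (σ + t / 2)) * Real.sin (XE u x) +
      Real.sin (SYE u P (σ - t / 2) (σ + t / 2)) * Real.sin (YE u x))) :
    s * (Real.sin (SXE u P (σ - t / 2) (σ + t / 2)) * (VXE u (σ + t / 2) - VXE u (σ - t / 2)) +
        Real.sin (SYE u P (σ - t / 2) (σ + t / 2)) * (VYE u (σ + t / 2) - VYE u (σ - t / 2)) +
        fderiv ℝ δ (momE u P (σ - t / 2) (σ + t / 2))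
          ![(VXE u (σ + t / 2) - VXE u (σ - t / 2)) / 2, (VYE u (σ + t / 2) - VYE u (σ - t / 2)) / 2]) ≤ -(B.hmin / 2) * t := by
  set S := momE u P (σ - t / 2) (σ + t / 2) with hS
  set μ' := μ - δ S with hμ'def
  have hz := abs_le.1 (hδ S)
  have hη₀ : 0 ≤ η₀ := (abs_nonneg _).trans hF
  have hμ' : μ' ∈ Icc a b := ⟨by linarith [hz.2], by linarith [hz.1]⟩
  have hh' : |eps2 (SXE u P (σ - t / 2) (σ + t / 2)) (SYE u P (σ - t / 2) (σ + t / 2)) - μ'| ≤ η₀ := by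
    have : eps2 (SXE u P (σ - t / 2) (σ + t / 2)) (SYE u P (σ - t / 2) (σ + t / 2)) - μ' = hfunE δ u μ P (σ - t / 2) (σ + t / 2) := by
      rw [hμ'def, hS, hfunE]; ring
    rw [this]; exact hF
  have hgap : ∀ θ, |μ' - (μ - δ (u θ • dir θ))| ≤ 2 * κ₀ := by
    intro θ
    have h1 := abs_le.1 (hδ (u θ • dir θ))
    rw [hμ'def, abs_le]; constructor <;> linarith [hz.1, hz.2]
  have e : h3E δ u P (σ + t / 2) (σ - t / 2) + h3E δ u P (σ - t / 2) (σ + t / 2) =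
      (2 * Real.sin (SXE u P (σ - t / 2) (σ + t / 2)) * VXE u (σ - t / 2) + 2 * Real.sin (SYE u P (σ - t / 2) (σ + t / 2)) * VYE u (σ - t / 2) +
          fderiv ℝ δ S ![VXE u (σ - t / 2), VYE u (σ - t / 2)]) +
        (2 * Real.sin (SXE u P (σ - t / 2) (σ + t / 2)) * VXE u (σ + t / 2) + 2 * Real.sin (SYE u P (σ - t / 2) (σ + t / 2)) * VYE u (σ + t / 2) +
          fderiv ℝ δ S ![VXE u (σ + t / 2), VYE u (σ + t / 2)]) := by
    rw [hS]; unfold h3E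
    rw [SXE_swap u P (σ + t / 2) (σ - t / 2), SYE_swap u P (σ + t / 2) (σ - t / 2), momE_swap u P (σ + t / 2) (σ - t / 2)]
  rw [e] at hG
  exact even_key_perturbed_signed B hδs hδ hlo hhi hκ hκ₁ hκ₂ hu hs01 ht0 htτ hμ' (by linarith [hz.2]) (by linarith [hz.1]) hh' hgap hG hsmall
    hρ hι hI


end FoldSigned

end Summit.HubbardSuperconductivity.HubbardSuperconductivity.Theorems.PerturbedFermiCurve

end
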